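import Summits.QuantumFields.BalabanUV.T4Continuum.Spine.NE9.DirectPairingCrossover
import Literature.MathematicalPhysics.QuantumFieldTheory.Balaban1983to89.T4GoodClassBudget

/-!
# T⁴ programme, spine estimate NE9 — THE RATE THE CONSECUTIVE LOG WINDOW WOULD ASK OF THE E-SIDE: a polynomial profile `b_j = O(j^{−p})` with
# `p > C·log Λ` passes node U5b's rate-only deviation slot on the `summable`-budget window `jlogOf C` — census item C42 (quantitative side) of cell
# `pub-balaban-gaps`, seat ne9 (gen 12)

Cell `pub-balaban-gaps` (YM blitz G2, seat ne9, unit `pub-balaban-gaps-ne9-g12`; record `run/shared/lean/pub/pub-balaban-gaps/ne/NE9.md` §5 row C42).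
Summits-side bookkeeping over the tree's node-U5b vocabulary (`T4GoodClassBudget.jlogOf`, the logarithmic recent-window cut the CONSECUTIVE organisation is forced to use:
`summable_weightMajorant_log`, `T4MatchingClosure.relWeightBound_of_slotDom_log`).  Companion of `DirectPairingEnd` (C42: with the `summable` fields of
`RelWeightBound` ∕ `ShellWeightBound` in force NO window passes a merely qualitative profile — `summableBudget_window_not_tendsto'`).  NO definition; nothing of
Bałaban's asserted.

WHY.  C42 located the one field of the cell's node-U5 design that King's adapted window cannot meet (`Summable W`) and showed it two-sidedly: kept, it kills every
qualitative profile at node U5b's rate-only deviation slot (`b_j = 1∕log(j+2)` defeats every summable-budget window); dropped (it is idle for King's matching), the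
E-side END composes (`king_end_of_window`).  The census row states the ALTERNATIVE in prose: «with the fields kept the E-side would owe a RATE — `b_j ≤ B(j+1)^{−p}`,
`p > C log Λ` on the log window».  This file types that sentence, so that C42's dichotomy is a kernel statement on both sides:
* §1 `windowSum_le_card_mul`: `Σ_{j=J}^{K} b_jΛ^{K−j} ≤ (K+1−J)·B·Λ^{K−J}` for `Λ ≥ 1`, `0 ≤ B`, `b ≤ B` on the window (card × sup × `Λ^{width}`).
* §2 `logWidth_div_tendsto` (`⌈C log(K+1)⌉∕(K+1) → 0`, Mathlib `Real.isLittleO_log_id_atTop`) and **`logWindow_tendsto_of_polyRate`**: `Λ ≥ 1`, `C ≥ 0`,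
  `0 ≤ b_j ≤ D(j+1)^{−p}`, `p > C·log Λ` ⇒ `Σ_{j=jlogOf C K}^{K} b_jΛ^{K−j} → 0` (§1 with `B = D(K−⌈C log(K+1)⌉+1)^{−p}`; `Λ^{⌈C log(K+1)⌉} ≤ Λ(K+1)^{C log Λ}`;
  `(K−⌈…⌉+1)^{−p} ≤ 2^p(K+1)^{−p}` eventually; `log(K+1)(K+1)^{−(p−C log Λ)} → 0` by `isLittleO_log_rpow_atTop`, `tendsto_rpow_neg_atTop`).

VERDICT FOR THE ROW (C42, quantitative side).  The dichotomy at node U5b's deviation slot is typed on both sides: EITHER the design keeps the consecutive currency's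
`summable` bad-class fields — then the recent window is logarithmic and the E-side owes a POLYNOMIAL RATE `p > C log Λ` for its scale profile (a quantitative modulus of
continuity in the young couplings — C25's currency — sufficient by this file; a merely qualitative profile insufficient by `DirectPairingEnd.summableBudget_window_not_tendsto'`),
OR the fields are dropped (idle for King: `DirectPairingEnd.cauchy_of_goodClause`) — then «a scale profile `b_j → 0`» suffices through the adapted window
(`DirectPairingWindow.exists_kingWindow`, `DirectPairingEnd.king_end_of_window`).  The threshold `C log Λ` couples NE7b's bad-class rate (`C(−log r₀) > 1`) to the
multiplicity base (`Λ = L⁴`): `p > log Λ ∕ (−log r₀)` is the net condition.  NOTHING new is owed on the King route; W1 (instance 0∕1) unchanged.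

HONEST FRAMING: bookkeeping for rung (B)+1 on ONE FIXED finite four-torus; elementary real analysis on hypothesis SHAPES (H-U5b-1, NE7b's bad-class budget — the cell's
located new estimates, none in print for Bałaban's d = 4 procedure); NE9 NOT PRINTED ∕ NOT PROVED; spine PROVED 0∕9 unchanged; NOT UV stability, NOT the continuum
limit, NOT infinite volume, NOT a mass gap, NOT Clay.  HONEST DEPENDENCY: continuum YM on T⁴ ⇐ BetaPertH ∧ nine spine estimates (0∕9 proved); BetaPertH ⇐ (D1) ∧ (D4) ∧
CAP+tail.

References (TYPES only): [King1986] = C. King, Commun. Math. Phys. **102** (1986) 649–677, p. 657; [Balaban1988Convergent] = T. Bałaban, Commun. Math. Phys. **119**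
(1988) 243–285, p. 262 («The constant E_k (depending on {Ω_j}, {Λ_j} also)»).
-/

namespace Summit.QuantumFields.BalabanUV.T4Continuum.NE9.DirectPairingRate

open scoped BigOperators
open Finset Filter Topology Asymptotics
open Literature.MathematicalPhysics.QuantumFieldTheory.Balaban1983to89
open T4GoodClassBudget (jlogOf)

/-! ## §1 A window sum is at most (width + 1) × (sup of the profile on the window) × Λ^{width} -/

/-- **WINDOW SUM ≤ CARD × SUP × Λ^{WIDTH}.**  For `Λ ≥ 1`, `B ≥ 0` and a profile with `b_j ≤ B` on the window `J ≤ j ≤ K`: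
`Σ_{j=J}^{K} b_j·Λ^{K−j} ≤ (K + 1 − J)·B·Λ^{K−J}`. [folklore] -/
theorem windowSum_le_card_mul {b : ℕ → ℝ} {Λ B : ℝ} {J K : ℕ} (hΛ : 1 ≤ Λ) (hB : 0 ≤ B)
    (hb : ∀ j, J ≤ j → j ≤ K → b j ≤ B) :
    ∑ j ∈ Icc J K, b j * Λ ^ (K - j) ≤ ((K + 1 - J : ℕ) : ℝ) * (B * Λ ^ (K - J)) := by
  have h := Finset.sum_le_card_nsmul (Icc J K) (fun j => b j * Λ ^ (K - j)) (B * Λ ^ (K - J)) fun j hj => by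
    rw [mem_Icc] at hj
    exact mul_le_mul (hb j hj.1 hj.2) (pow_le_pow_right₀ hΛ (by omega)) (pow_nonneg (by linarith) _) hB
  rw [Nat.card_Icc, nsmul_eq_mul] at h
  exact h

/-! ## §2 On the consecutive LOG window a POLYNOMIAL rate with exponent `p > C·log Λ` passes the rate-only deviation slot -/

/-- The log-window width `⌈C·log(K+1)⌉` is `o(K)`: `⌈C log(K+1)⌉₊ ∕ (K+1) → 0` for `C ≥ 0`. [folklore] -/
theorem logWidth_div_tendsto {C : ℝ} (hC : 0 ≤ C) :
    Tendsto (fun K : ℕ => (⌈C * Real.log ((K : ℝ) + 1)⌉₊ : ℝ) / ((K : ℝ) + 1)) atTop (𝓝 0) := by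
  have hK1 : Tendsto (fun K : ℕ => (K : ℝ) + 1) atTop atTop :=
    tendsto_atTop_add_const_right _ _ tendsto_natCast_atTop_atTop
  -- `log x / x → 0` along `x = K + 1`, and `1/(K+1) → 0`
  have hlog : Tendsto (fun K : ℕ => Real.log ((K : ℝ) + 1) / ((K : ℝ) + 1)) atTop (𝓝 0) :=
    (Real.isLittleO_log_id_atTop.tendsto_div_nhds_zero).comp hK1
  have hinv : Tendsto (fun K : ℕ => 1 / ((K : ℝ) + 1)) atTop (𝓝 0) := tendsto_one_div_add_atTop_nhds_zero_nat
  have hup : Tendsto (fun K : ℕ => C * (Real.log ((K : ℝ) + 1) / ((K : ℝ) + 1)) + 1 / ((K : ℝ) + 1)) atTop (𝓝 0) := by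
    simpa using (hlog.const_mul C).add hinv
  refine squeeze_zero (fun K => by positivity) (fun K => ?_) hup
  have hK : (0 : ℝ) < (K : ℝ) + 1 := by positivity
  have hceil : (⌈C * Real.log ((K : ℝ) + 1)⌉₊ : ℝ) ≤ C * Real.log ((K : ℝ) + 1) + 1 :=
    (Nat.ceil_lt_add_one (mul_nonneg hC (Real.log_nonneg (by linarith)))).le
  calc (⌈C * Real.log ((K : ℝ) + 1)⌉₊ : ℝ) / ((K : ℝ) + 1) ≤ (C * Real.log ((K : ℝ) + 1) + 1) / ((K : ℝ) + 1) :=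
        div_le_div_of_nonneg_right hceil hK.le
    _ = C * (Real.log ((K : ℝ) + 1) / ((K : ℝ) + 1)) + 1 / ((K : ℝ) + 1) := by ring

/-- **A POLYNOMIAL RATE PASSES THE LOG WINDOW.**  Let `Λ ≥ 1` (multiplicity base), `C ≥ 0` (the consecutive log cut `T4GoodClassBudget.jlogOf C K = K − ⌈C log(K+1)⌉`,
forced by the `summable` bad-class fields), and a profile `0 ≤ b_j ≤ D·(j+1)^{−p}` with `p > C·log Λ`.  Then the rate-only deviation window sum
`Σ_{j=jlog(K)}^{K} b_j·Λ^{K−j}` tends to zero: by §1 it is `≤ (⌈C log(K+1)⌉ + 1)·D(K − ⌈C log(K+1)⌉ + 1)^{−p}·Λ^{⌈C log(K+1)⌉}`, and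
`Λ^{⌈C log(K+1)⌉} ≤ Λ·(K+1)^{C log Λ}`, `(K − ⌈C log(K+1)⌉ + 1)^{−p} ≤ 2^p(K+1)^{−p}` eventually, `log(K+1)·(K+1)^{−(p − C log Λ)} → 0`.  This is the RATE the
E-side owes node U5b's deviation slot when the `summable` fields of `RelWeightBound` ∕ `ShellWeightBound` are kept (`DirectPairingEnd.summableBudget_window_not_tendsto'`:
a merely qualitative profile does not pass ANY summable-budget window) — a quantitative modulus in the young couplings, the currency King's organisation does NOT need
(`DirectPairingWindow.exists_kingWindow` + `DirectPairingEnd.cauchy_of_reindexedBudget₀`). [folklore] -/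
theorem logWindow_tendsto_of_polyRate {b : ℕ → ℝ} {Λ C D p : ℝ} (hΛ : 1 ≤ Λ) (hC : 0 ≤ C) (hD : 0 ≤ D)
    (hb0 : ∀ j, 0 ≤ b j) (hb : ∀ j : ℕ, b j ≤ D * ((j : ℝ) + 1) ^ (-p)) (hp : C * Real.log Λ < p) :
    Tendsto (fun K : ℕ => ∑ j ∈ Icc (jlogOf C K) K, b j * Λ ^ (K - j)) atTop (𝓝 0) := by
  have hp0 : 0 < p := lt_of_le_of_lt (mul_nonneg hC (Real.log_nonneg hΛ)) hp
  set q : ℝ := p - C * Real.log Λ with hq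
  have hq0 : 0 < q := by rw [hq]; linarith
  -- the width
  set N : ℕ → ℕ := fun K => ⌈C * Real.log ((K : ℝ) + 1)⌉₊ with hN
  have hjlog : ∀ K, jlogOf C K = K - N K := fun K => rfl
  have hK1 : ∀ K : ℕ, (0 : ℝ) < (K : ℝ) + 1 := fun K => by positivity
  have hNle : ∀ K : ℕ, (N K : ℝ) ≤ C * Real.log ((K : ℝ) + 1) + 1 := fun K =>
    (Nat.ceil_lt_add_one (mul_nonneg hC (Real.log_nonneg (by linarith [hK1 K])))).le
  -- §1 bound with B = D (K − N K + 1)^{−p}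
  have hstep1 : ∀ K : ℕ, ∑ j ∈ Icc (jlogOf C K) K, b j * Λ ^ (K - j)
      ≤ ((N K : ℝ) + 1) * (D * (((K - N K : ℕ) : ℝ) + 1) ^ (-p) * Λ ^ N K) := by
    intro K
    rw [hjlog]
    have hBnn : 0 ≤ D * (((K - N K : ℕ) : ℝ) + 1) ^ (-p) := mul_nonneg hD (Real.rpow_nonneg (by positivity) _)
    have h1 := windowSum_le_card_mul (b := b) (K := K) (J := K - N K) hΛ hBnn fun j hJ _ => by
      refine (hb j).trans (mul_le_mul_of_nonneg_left ?_ hD)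
      exact Real.rpow_le_rpow_of_nonpos (by positivity) (by exact_mod_cast Nat.add_le_add_right hJ 1) (by linarith)
    refine h1.trans ?_
    have hcard : (((K + 1 - (K - N K)) : ℕ) : ℝ) ≤ (N K : ℝ) + 1 := by
      have : K + 1 - (K - N K) ≤ N K + 1 := by omega
      exact_mod_cast this
    have hpow : Λ ^ (K - (K - N K)) ≤ Λ ^ N K := pow_le_pow_right₀ hΛ (by omega)
    calc (((K + 1 - (K - N K)) : ℕ) : ℝ) * (D * (((K - N K : ℕ) : ℝ) + 1) ^ (-p) * Λ ^ (K - (K - N K)))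
        ≤ ((N K : ℝ) + 1) * (D * (((K - N K : ℕ) : ℝ) + 1) ^ (-p) * Λ ^ (K - (K - N K))) :=
          mul_le_mul_of_nonneg_right hcard (mul_nonneg hBnn (pow_nonneg (by linarith) _))
      _ ≤ ((N K : ℝ) + 1) * (D * (((K - N K : ℕ) : ℝ) + 1) ^ (-p) * Λ ^ N K) :=
          mul_le_mul_of_nonneg_left (mul_le_mul_of_nonneg_left hpow hBnn) (by positivity)
  -- Λ^{N K} ≤ Λ · (K+1)^{C log Λ}
  have hstep2 : ∀ K : ℕ, Λ ^ N K ≤ Λ * ((K : ℝ) + 1) ^ (C * Real.log Λ) := by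
    intro K
    have hΛ0 : 0 < Λ := by linarith
    calc Λ ^ N K = Λ ^ ((N K : ℕ) : ℝ) := (Real.rpow_natCast Λ (N K)).symm
      _ ≤ Λ ^ (C * Real.log ((K : ℝ) + 1) + 1) := Real.rpow_le_rpow_of_exponent_le hΛ (hNle K)
      _ = Λ * ((K : ℝ) + 1) ^ (C * Real.log Λ) := by
          rw [Real.rpow_add hΛ0, Real.rpow_one, mul_comm, Real.rpow_def_of_pos hΛ0, Real.rpow_def_of_pos (hK1 K)]
          congr 1; ring_nf
  -- eventually N K ≤ (K+1)/2, hence (K − N K + 1)^{−p} ≤ 2^p (K+1)^{−p}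
  have hev : ∀ᶠ K : ℕ in atTop, (((K - N K : ℕ) : ℝ) + 1) ^ (-p) ≤ (2 : ℝ) ^ p * ((K : ℝ) + 1) ^ (-p) := by
    have h := (logWidth_div_tendsto hC).eventually (gt_mem_nhds (show (0 : ℝ) < 1 / 2 by norm_num))
    filter_upwards [h] with K hK
    have hNK : (N K : ℝ) < ((K : ℝ) + 1) / 2 := by
      have := (div_lt_iff₀ (hK1 K)).mp hK
      linarith
    have hNK' : N K ≤ K := by
      have : (N K : ℝ) < (K : ℝ) + 1 := by linarith [hK1 K]
      exact_mod_cast Nat.lt_succ_iff.mp (by exact_mod_cast this)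
    have hcast : (((K - N K : ℕ) : ℝ)) = (K : ℝ) - N K := by rw [Nat.cast_sub hNK']
    have hge : ((K : ℝ) + 1) / 2 ≤ ((K - N K : ℕ) : ℝ) + 1 := by rw [hcast]; linarith
    calc (((K - N K : ℕ) : ℝ) + 1) ^ (-p) ≤ (((K : ℝ) + 1) / 2) ^ (-p) :=
          Real.rpow_le_rpow_of_nonpos (by positivity) hge (by linarith)
      _ = (2 : ℝ) ^ p * ((K : ℝ) + 1) ^ (-p) := by
          rw [Real.div_rpow (hK1 K).le (by norm_num), Real.rpow_neg (by norm_num : (0:ℝ) ≤ 2), div_inv_eq_mul, mul_comm]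
  -- the majorant `(C log(K+1) + 2) · D · 2^p · Λ · (K+1)^{−q}` tends to zero
  have hmaj : Tendsto (fun K : ℕ => (C * Real.log ((K : ℝ) + 1) + 2) * (D * ((2 : ℝ) ^ p * ((K : ℝ) + 1) ^ (-p))
      * (Λ * ((K : ℝ) + 1) ^ (C * Real.log Λ)))) atTop (𝓝 0) := by
    have hK1t : Tendsto (fun K : ℕ => (K : ℝ) + 1) atTop atTop :=
      tendsto_atTop_add_const_right _ _ tendsto_natCast_atTop_atTop
    -- log x · x^{−q} → 0 and x^{−q} → 0
    have hlq : Tendsto (fun x : ℝ => Real.log x / x ^ q) atTop (𝓝 0) := (isLittleO_log_rpow_atTop hq0).tendsto_div_nhds_zero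
    have hxq : Tendsto (fun x : ℝ => x ^ (-q)) atTop (𝓝 0) := tendsto_rpow_neg_atTop hq0
    have hA : Tendsto (fun K : ℕ => (C * (Real.log ((K : ℝ) + 1) / ((K : ℝ) + 1) ^ q) + 2 * ((K : ℝ) + 1) ^ (-q))
        * (D * (2 : ℝ) ^ p * Λ)) atTop (𝓝 0) := by
      simpa using (((hlq.comp hK1t).const_mul C).add ((hxq.comp hK1t).const_mul 2)).mul_const (D * (2 : ℝ) ^ p * Λ)
    refine hA.congr' (Eventually.of_forall fun K => ?_)
    have hx : (0 : ℝ) < (K : ℝ) + 1 := hK1 K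
    have e1 : ((K : ℝ) + 1) ^ (-p) * ((K : ℝ) + 1) ^ (C * Real.log Λ) = ((K : ℝ) + 1) ^ (-q) := by
      rw [← Real.rpow_add hx]; congr 1; rw [hq]; ring
    have e2 : Real.log ((K : ℝ) + 1) / ((K : ℝ) + 1) ^ q = Real.log ((K : ℝ) + 1) * ((K : ℝ) + 1) ^ (-q) := by
      rw [Real.rpow_neg hx.le, div_eq_mul_inv]
    simp only [e2]
    calc (C * (Real.log ((K : ℝ) + 1) * ((K : ℝ) + 1) ^ (-q)) + 2 * ((K : ℝ) + 1) ^ (-q)) * (D * (2 : ℝ) ^ p * Λ)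
        = (C * Real.log ((K : ℝ) + 1) + 2) * (D * (2 : ℝ) ^ p * Λ) * ((K : ℝ) + 1) ^ (-q) := by ring
      _ = (C * Real.log ((K : ℝ) + 1) + 2) * (D * ((2 : ℝ) ^ p * ((K : ℝ) + 1) ^ (-p))
          * (Λ * ((K : ℝ) + 1) ^ (C * Real.log Λ))) := by rw [← e1]; ring
  -- squeeze
  refine squeeze_zero' (Eventually.of_forall fun K => sum_nonneg fun j _ => mul_nonneg (hb0 j) (pow_nonneg (by linarith) _))
    ?_ hmaj
  filter_upwards [hev] with K hK
  refine (hstep1 K).trans ?_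
  have hΛ0 : 0 ≤ Λ := by linarith
  have hlogK : 0 ≤ Real.log ((K : ℝ) + 1) := Real.log_nonneg (by linarith [hK1 K])
  have hN2 : (N K : ℝ) + 1 ≤ C * Real.log ((K : ℝ) + 1) + 2 := by linarith [hNle K]
  have hB1 : D * (((K - N K : ℕ) : ℝ) + 1) ^ (-p) ≤ D * ((2 : ℝ) ^ p * ((K : ℝ) + 1) ^ (-p)) :=
    mul_le_mul_of_nonneg_left hK hD
  have hB1nn : 0 ≤ D * (((K - N K : ℕ) : ℝ) + 1) ^ (-p) := mul_nonneg hD (Real.rpow_nonneg (by positivity) _)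
  calc ((N K : ℝ) + 1) * (D * (((K - N K : ℕ) : ℝ) + 1) ^ (-p) * Λ ^ N K)
      ≤ (C * Real.log ((K : ℝ) + 1) + 2) * (D * (((K - N K : ℕ) : ℝ) + 1) ^ (-p) * Λ ^ N K) :=
        mul_le_mul_of_nonneg_right hN2 (mul_nonneg hB1nn (pow_nonneg hΛ0 _))
    _ ≤ (C * Real.log ((K : ℝ) + 1) + 2) * (D * ((2 : ℝ) ^ p * ((K : ℝ) + 1) ^ (-p))
          * (Λ * ((K : ℝ) + 1) ^ (C * Real.log Λ))) := by
        refine mul_le_mul_of_nonneg_left ?_ (by positivity)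
        exact mul_le_mul hB1 (hstep2 K) (pow_nonneg hΛ0 _) (by positivity)

end Summit.QuantumFields.BalabanUV.T4Continuum.NE9.DirectPairingRate
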